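import Literature.MathematicalPhysics.KineticTheory.SiteChainResponseIdentity
import Literature.MathematicalPhysics.KineticTheory.SiteChainKernelContinuity
import Literature.MathematicalPhysics.KineticTheory.SiteChainGibbsWeight
import Mathlib.MeasureTheory.Integral.ExpDecay
import HarnessLib

/-!
# Continuity of the odd-moment pairing in the temperature bias, from a UNIFORM mixing estimate

Topic `Literature/MathematicalPhysics/KineticTheory`, grouping namespace `…KineticTheory.HeatConduction`.
For a uniformly confining site-dependent chain (`N ≥ 1`, `γ > 0`), `T > 0`, and an observable `φ`
(continuous, `|φ| ≤ C_φ e^{(ϑ/2)H}`), the Lebesgue odd-moment pairing of the biased kernels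
`P^δ_s = langevinKernel N (T+δ/2) (T-δ/2) s`,

  `I(δ) = ∫₀^∞ ∫ P^δ_s φ(x) · e^{-H(x)/T} (p_0² - p_{N-1}²) dx ds`,

is continuous at `δ = 0` (along `δ ≠ 0`) provided the kernels satisfy a `V`-uniform mixing estimate
with constants UNIFORM in `|δ| < δ₀` (`SiteChain.UniformlyConfining.tendsto_oddMoment_pairing_of_uniform_mixing`):
pointwise continuity in `δ` of the forecasts (`SiteChainKernelContinuity.lean`), the vanishing of the
odd Gibbs moment `∫ e^{-H/T}(p_0² - p_{N-1}²) dx = 0` (`SiteChainResponseIdentity.lean`), dominated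
convergence in `x` (uniform moment bound) and in `s` (uniform majorant `K e^{-cs}`). This is the
continuity input (CONT) of the finite-volume linear response `lim_{δ→0} ν_δ(J)/δ` of the chain.

## References

* N. Cuneo, J.-P. Eckmann, M. Hairer, L. Rey-Bellet, Electron. J. Probab. **23** (2018) no. 55,
  Thm 2.13 eq. (2.5).
* A. Kundu, A. Dhar, O. Narayan, J. Stat. Mech. (2009) L03001, p. 3.
* F. Bonetto, J. L. Lebowitz, L. Rey-Bellet (2000), §5.3 eq. (31)–(33).
-/

noncomputable section

open MeasureTheory ProbabilityTheory Filter Topology Set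
open scoped NNReal ENNReal ContDiff

namespace Literature.MathematicalPhysics.KineticTheory.HeatConduction

open Literature.Probability.Process Literature.MathematicalPhysics.KineticTheory

variable {N : ℕ}

namespace SiteChain.UniformlyConfining

variable {P : SiteChain} (hP : P.UniformlyConfining)
include hP

/-- **(CONT) from a uniform mixing estimate.** If for `|δ| < δ₀` (`0 < δ₀ < 2T`) the kernels at
`(T+δ/2, T-δ/2)` admit probability measures `ν_δ` with `ν_δ(e^{ϑH}) ≤ C` and
`|P^δ_t f(z) - ν_δ(f)| ≤ C e^{ϑH(z)} e^{-ct}` for continuous `|f| ≤ e^{ϑH}` (`0 < ϑ < 1/T`, `c > 0`, the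
SAME constants for all such `δ`), and `e^{aH} ∈ L¹(dx)` for `a < 0`, then for continuous `φ` with
`|φ| ≤ C_φ e^{(ϑ/2)H}` the odd-moment pairing `δ ↦ ∫₀^∞ ∫ P^δ_s φ · e^{-H/T}(p_0² - p_{N-1}²) dx ds` tends,
as `δ → 0` (`δ ≠ 0`), to its value at the equilibrium kernels. [cite: CuneoEckmannHairerReyBellet2018, Thm 2.13 eq. (2.5)] -/
theorem tendsto_oddMoment_pairing_of_uniform_mixing (hN : 0 < N) (hγ : 0 < P.γ) {T : ℝ} (hT : 0 < T)
    {ϑ C c δ₀ : ℝ} (hδ₀ : 0 < δ₀) (hδ₀T : δ₀ < 2 * T) (hϑ : 0 < ϑ) (hϑT : -1 / T + ϑ < 0) (hc : 0 < c)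
    (hZ : ∀ a : ℝ, a < 0 → Integrable fun x : PhaseSpace N => Real.exp (a * P.hamiltonian N x))
    (hU : ∀ δ : ℝ, |δ| < δ₀ → ∃ ν : Measure (PhaseSpace N), IsProbabilityMeasure ν ∧
      (∫ y, Real.exp (ϑ * P.hamiltonian N y) ∂ν ≤ C) ∧
      ∀ (z : PhaseSpace N) (t : ℝ≥0) (f : PhaseSpace N → ℝ), Continuous f →
        (∀ y, |f y| ≤ Real.exp (ϑ * P.hamiltonian N y)) →
        |(∫ y, f y ∂(P.langevinKernel N (T + δ / 2) (T - δ / 2) t z)) - ∫ y, f y ∂ν| ≤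
          C * Real.exp (ϑ * P.hamiltonian N z) * Real.exp (-c * t))
    {φ : PhaseSpace N → ℝ} (hφc : Continuous φ) {Cφ : ℝ}
    (hφ : ∀ y, |φ y| ≤ Cφ * Real.exp (ϑ / 2 * P.hamiltonian N y)) :
    Tendsto (fun δ : ℝ => ∫ s in Ioi (0 : ℝ), ∫ x,
        (∫ y, φ y ∂(P.langevinKernel N (T + δ / 2) (T - δ / 2) s.toNNReal x)) *
          (Real.exp (-1 / T * P.hamiltonian N x) * (x.2 ⟨0, hN⟩ ^ 2 - x.2 ⟨N - 1, by omega⟩ ^ 2)))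
      (𝓝[≠] 0)
      (𝓝 (∫ s in Ioi (0 : ℝ), ∫ x, (∫ y, φ y ∂(P.langevinKernel N T T s.toNNReal x)) *
          (Real.exp (-1 / T * P.hamiltonian N x) * (x.2 ⟨0, hN⟩ ^ 2 - x.2 ⟨N - 1, by omega⟩ ^ 2)))) := by
  set Hm := P.hamiltonian N with hHm
  have hHc : Continuous Hm := (hP.contDiff_hamiltonian N).continuous
  have hH0 := hP.hamiltonian_nonneg N
  have hφm := hφc.stronglyMeasurable
  -- the uniform exponential moment bound, `|δ| < δ₀`
  have hKu : ∀ δ : ℝ, |δ| < δ₀ → ∀ (t : ℝ≥0) (x : PhaseSpace N),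
      ∫⁻ y, ENNReal.ofReal (Real.exp (ϑ * Hm y)) ∂(P.langevinKernel N (T + δ / 2) (T - δ / 2) t x) ≤
        ENNReal.ofReal (2 * C * Real.exp (0 * t) * Real.exp (ϑ * Hm x)) := by
    intro δ hδ
    obtain ⟨ν, hνP, hνC, hmix⟩ := hU δ hδ
    exact (hP.exp_moment_bound_of_mixing N (T + δ / 2) (T - δ / 2) hϑ.le hc.le hνC hmix).2
  -- `C ≥ 0`
  have hC0 : 0 ≤ C := by
    obtain ⟨ν, hνP, -, hmix⟩ := hU 0 (by rw [abs_zero]; exact hδ₀)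
    have h := hmix 0 0 (fun _ => 0) continuous_const (fun y => by rw [abs_zero]; exact (Real.exp_pos _).le)
    simp only [integral_zero, sub_self, abs_zero, NNReal.coe_zero, mul_zero, Real.exp_zero, mul_one] at h
    exact nonneg_of_mul_nonneg_left h (Real.exp_pos _)
  have hK0 : (0 : ℝ) ≤ 2 * C := by positivity
  -- `|φ| ≤ M e^{(ϑ/2)H} ≤ M e^{ϑH}` with `M > 0`
  set M : ℝ := |Cφ| + 1 with hMdef
  have hM : 0 < M := by positivity
  have hφM' : ∀ y, |φ y| ≤ M * Real.exp (ϑ / 2 * Hm y) := fun y =>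
    (hφ y).trans (mul_le_mul_of_nonneg_right (by rw [hMdef]; linarith [le_abs_self Cφ]) (Real.exp_pos _).le)
  have hφM : ∀ y, |φ y| ≤ M * Real.exp (ϑ * Hm y) := fun y =>
    (hφM' y).trans (mul_le_mul_of_nonneg_left (Real.exp_le_exp.2 (by nlinarith [hH0 y])) hM.le)
  -- integrable weights
  have hI0 : Integrable fun x : PhaseSpace N => Real.exp ((-1 / T + ϑ) * Hm x) := hZ _ hϑT
  have hI1 : Integrable fun x : PhaseSpace N =>
      (1 + x.2 ⟨0, hN⟩ ^ 2 + x.2 ⟨N - 1, by omega⟩ ^ 2) * Real.exp ((-1 / T + ϑ) * Hm x) :=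
    hP.integrable_momentSq_mul_exp_mul_hamiltonian hN hϑT (hZ _ (by linarith))
  -- the weight `w = e^{-H/T}(p_0² - p_{N-1}²)` and `∫ w = 0`
  set w : PhaseSpace N → ℝ := fun x => Real.exp (-1 / T * Hm x) * (x.2 ⟨0, hN⟩ ^ 2 - x.2 ⟨N - 1, by omega⟩ ^ 2)
    with hwdef
  have hwc : Continuous w := (Real.continuous_exp.comp (continuous_const.mul hHc)).mul
    ((((continuous_apply _).comp continuous_snd).pow 2).sub (((continuous_apply _).comp continuous_snd).pow 2))
  have hwb : ∀ x, |w x| ≤ (1 + x.2 ⟨0, hN⟩ ^ 2 + x.2 ⟨N - 1, by omega⟩ ^ 2) * Real.exp (-1 / T * Hm x) := fun x => by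
    rw [hwdef]; simp only
    rw [abs_mul, abs_of_pos (Real.exp_pos _), mul_comm]
    refine mul_le_mul_of_nonneg_right ?_ (Real.exp_pos _).le
    rw [abs_le]; constructor <;> nlinarith [sq_nonneg (x.2 ⟨0, hN⟩), sq_nonneg (x.2 ⟨N - 1, by omega⟩)]
  have hw0 : ∫ x, w x = 0 := by
    have hδ' : |δ₀ / 2| < δ₀ := by rw [abs_of_pos (half_pos hδ₀)]; exact half_lt_self hδ₀
    have hTL : 0 ≤ T + δ₀ / 2 / 2 := by linarith
    have hTR : 0 ≤ T - δ₀ / 2 / 2 := by linarith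
    exact hP.integral_expWeight_oddMoment_eq_zero (hKu _ hδ') hK0 le_rfl hN hT hTL hTR hI0 hI1 hϑ.le hγ
      (ne_of_gt (half_pos hδ₀))
  -- `|w| e^{ϑH}` is integrable
  have hgexp : Integrable (fun x => |w x| * Real.exp (ϑ * Hm x)) := by
    refine hI1.mono' (hwc.abs.mul (Real.continuous_exp.comp (continuous_const.mul hHc))).aestronglyMeasurable
      (Eventually.of_forall fun x => ?_)
    rw [Real.norm_eq_abs, abs_mul, abs_abs, abs_of_pos (Real.exp_pos _),
      show (-1 / T + ϑ) * Hm x = -1 / T * Hm x + ϑ * Hm x by ring, Real.exp_add]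
    calc |w x| * Real.exp (ϑ * Hm x) ≤ (1 + x.2 ⟨0, hN⟩ ^ 2 + x.2 ⟨N - 1, by omega⟩ ^ 2) * Real.exp (-1 / T * Hm x) *
          Real.exp (ϑ * Hm x) := mul_le_mul_of_nonneg_right (hwb x) (Real.exp_pos _).le
      _ = _ := by ring
  have hwint : Integrable w := by
    refine hI1.mono' hwc.aestronglyMeasurable (Eventually.of_forall fun x => ?_)
    rw [Real.norm_eq_abs]
    refine (hwb x).trans (mul_le_mul_of_nonneg_left (Real.exp_le_exp.2 ?_) (by positivity))
    have h0 : 0 ≤ Hm x := hH0 x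
    nlinarith
  -- the pairings `k δ s`
  set k : ℝ → ℝ → ℝ := fun δ s => ∫ x,
    (∫ y, φ y ∂(P.langevinKernel N (T + δ / 2) (T - δ / 2) s.toNNReal x)) * w x with hk
  -- (b) the uniform majorant
  set K₀ : ℝ := M * C * ∫ x, |w x| * Real.exp (ϑ * Hm x) with hK₀
  have hdom : ∀ δ : ℝ, |δ| < δ₀ → ∀ s : ℝ, 0 < s → |k δ s| ≤ K₀ * Real.exp (-c * s) := by
    intro δ hδ s hs
    obtain ⟨ν, hνP, hνC, hmix⟩ := hU δ hδ
    have hK := hKu δ hδ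
    set m : ℝ := ∫ y, φ y ∂ν with hm
    have hdecay : ∀ x : PhaseSpace N,
        |(∫ y, φ y ∂(P.langevinKernel N (T + δ / 2) (T - δ / 2) s.toNNReal x)) - m| ≤
          M * C * Real.exp (ϑ * Hm x) * Real.exp (-c * s) := by
      intro x
      have hf : ∀ y, |φ y / M| ≤ Real.exp (ϑ * Hm y) := fun y => by
        rw [abs_div, abs_of_pos hM, div_le_iff₀ hM, mul_comm]
        exact hφM y
      have h := hmix x s.toNNReal (fun y => φ y / M) (hφc.div_const M) hf
      rw [integral_div, integral_div, ← sub_div, abs_div, abs_of_pos hM, div_le_iff₀ hM,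
        Real.coe_toNNReal _ hs.le] at h
      calc _ ≤ C * Real.exp (ϑ * Hm x) * Real.exp (-c * s) * M := h
        _ = _ := by ring
    have hfm : Measurable fun x => ∫ y, φ y ∂(P.langevinKernel N (T + δ / 2) (T - δ / 2) s.toNNReal x) :=
      P.measurable_integral_langevinKernel N _ _ hφm _
    have hbd : ∀ x, |((∫ y, φ y ∂(P.langevinKernel N (T + δ / 2) (T - δ / 2) s.toNNReal x)) - m) * w x| ≤
        M * C * Real.exp (-c * s) * (|w x| * Real.exp (ϑ * Hm x)) := fun x => by
      rw [abs_mul]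
      calc _ ≤ (M * C * Real.exp (ϑ * Hm x) * Real.exp (-c * s)) * |w x| :=
            mul_le_mul_of_nonneg_right (hdecay x) (abs_nonneg _)
        _ = _ := by ring
    have hint1 : Integrable (fun x => ((∫ y, φ y ∂(P.langevinKernel N (T + δ / 2) (T - δ / 2) s.toNNReal x)) - m) * w x) :=
      ((hgexp.const_mul (M * C * Real.exp (-c * s))).mono'
        ((hfm.aestronglyMeasurable.sub aestronglyMeasurable_const).mul hwc.aestronglyMeasurable)
        (Eventually.of_forall fun x => by rw [Real.norm_eq_abs]; exact hbd x))
    have hint0 := hP.integrable_forecast_mul_oddMoment hK hφM hK0 hN hφm hI1 s.toNNReal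
    have hsplit : k δ s = ∫ x, ((∫ y, φ y ∂(P.langevinKernel N (T + δ / 2) (T - δ / 2) s.toNNReal x)) - m) * w x := by
      have e : (fun x => ((∫ y, φ y ∂(P.langevinKernel N (T + δ / 2) (T - δ / 2) s.toNNReal x)) - m) * w x) =
          fun x => (∫ y, φ y ∂(P.langevinKernel N (T + δ / 2) (T - δ / 2) s.toNNReal x)) * w x - m * w x := by
        funext x; ring
      rw [hk]; simp only
      rw [e, integral_sub hint0 (hwint.const_mul m), integral_const_mul, hw0, mul_zero, sub_zero]
    rw [hsplit]
    calc |∫ x, ((∫ y, φ y ∂(P.langevinKernel N (T + δ / 2) (T - δ / 2) s.toNNReal x)) - m) * w x|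
        ≤ ∫ x, |((∫ y, φ y ∂(P.langevinKernel N (T + δ / 2) (T - δ / 2) s.toNNReal x)) - m) * w x| :=
          abs_integral_le_integral_abs
      _ ≤ ∫ x, M * C * Real.exp (-c * s) * (|w x| * Real.exp (ϑ * Hm x)) :=
          integral_mono_of_nonneg (Eventually.of_forall fun x => abs_nonneg _) (hgexp.const_mul _) (Eventually.of_forall hbd)
      _ = K₀ * Real.exp (-c * s) := by rw [integral_const_mul, hK₀]; ring
  -- (c) pointwise continuity in `δ` at every `s`
  have hpt : ∀ s : ℝ, Tendsto (fun δ => k δ s) (𝓝 0)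
      (𝓝 (∫ x, (∫ y, φ y ∂(P.langevinKernel N T T s.toNNReal x)) * w x)) := by
    intro s
    have hball : ∀ᶠ δ : ℝ in 𝓝 0, |δ| < δ₀ := by
      have : Metric.ball (0 : ℝ) δ₀ ∈ 𝓝 (0 : ℝ) := Metric.ball_mem_nhds 0 hδ₀
      filter_upwards [this] with δ hδ
      simpa [Real.dist_eq] using hδ
    refine tendsto_integral_filter_of_dominated_convergence
      (fun x => M * (2 * C * Real.exp (0 * (s.toNNReal : ℝ)) * Real.exp (ϑ * Hm x)) * |w x|) ?_ ?_ ?_ ?_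
    · refine Eventually.of_forall fun δ => ?_
      exact (P.measurable_integral_langevinKernel N _ _ hφm _).aestronglyMeasurable.mul hwc.aestronglyMeasurable
    · filter_upwards [hball] with δ hδ
      refine Eventually.of_forall fun x => ?_
      rw [Real.norm_eq_abs, abs_mul]
      exact mul_le_mul_of_nonneg_right (hP.abs_integral_langevinKernel_le (hKu δ hδ) hφM hK0 s.toNNReal x) (abs_nonneg _)
    · refine (hgexp.const_mul (M * (2 * C))).mono' ?_ (Eventually.of_forall fun x => ?_)
      · exact ((continuous_const.mul (continuous_const.mul (Real.continuous_exp.comp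
          (continuous_const.mul hHc)))).mul hwc.abs).aestronglyMeasurable
      · rw [Real.norm_eq_abs, zero_mul, Real.exp_zero, mul_one, abs_of_nonneg (by positivity)]
        nlinarith [abs_nonneg (w x), Real.exp_pos (ϑ * Hm x)]
    · exact Eventually.of_forall fun x =>
        (hP.tendsto_integral_langevinKernel_temps hφc hδ₀ (half_lt_self hϑ) hK0 hKu hφM' s.toNNReal x).mul_const _
  -- (d) dominated convergence in `s`
  have hmeas : ∀ δ : ℝ, AEStronglyMeasurable (k δ) (volume.restrict (Ioi (0 : ℝ))) := fun δ =>
    (hP.measurable_oddMoment_pairing hN (T := T) (δ := δ) hφm).aestronglyMeasurable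
  have hev : ∀ᶠ δ : ℝ in 𝓝[≠] (0 : ℝ), |δ| < δ₀ := by
    have : ∀ᶠ δ : ℝ in 𝓝 0, δ ∈ Ioo (-δ₀) δ₀ := Ioo_mem_nhds (by linarith) hδ₀
    exact mem_nhdsWithin_of_mem_nhds (this.mono fun δ hδ => abs_lt.2 ⟨hδ.1, hδ.2⟩)
  exact tendsto_integral_filter_of_dominated_convergence (μ := volume.restrict (Ioi (0 : ℝ)))
    (l := 𝓝[≠] (0 : ℝ)) (F := fun δ s => k δ s) (fun s => K₀ * Real.exp (-c * s))
    (Eventually.of_forall hmeas)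
    (hev.mono fun δ hδ => (ae_restrict_iff' measurableSet_Ioi).2 (Eventually.of_forall fun s hs => by
      rw [Real.norm_eq_abs]; exact hdom δ hδ s hs))
    ((exp_neg_integrableOn_Ioi 0 hc).const_mul K₀)
    (Eventually.of_forall fun s => (hpt s).mono_left nhdsWithin_le_nhds)

end SiteChain.UniformlyConfining

end Literature.MathematicalPhysics.KineticTheory.HeatConduction
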